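import Summits.CriticalPhenomena.PercolationContinuityZ3.Theorems.PercNearOneGluingNoHeavyLowerTailTwoPartitionFibre
import Summits.CriticalPhenomena.PercolationContinuityZ3.Theorems.PercNearOneGluingNoHeavyLowerTailTwoPartitionJuntaLift
import Mathlib.Logic.Equiv.Sum
import HarnessLib.Audit

/-!
# `NoHeavyLowerTail` (crux stmt-CriticalPhenomena-4575), master-family hierarchy P3 (gen 26): the junta lift of the three-set antipodal
# functional on an ARBITRARY finite cube — `ThreeSetAntipodal` for all cubes of dimension `≤ k` implies it for every up-set `𝒜 ⊆ 2^α`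
# that depends on at most `k` coordinates, in every dimension

Support file (seat `prim-masterthm-p3`; `--supports stmt-CriticalPhenomena-4575`; memo
`run/shared/lean/prim/prim-masterthm/FROM-prim-masterthm-p3-g26-JUNTA-LIFT-AND-K6-CENSUS.md`, HIERARCHY §34).  Combines
`…TwoPartitionJuntaLift` (`threeSetN_nonneg_of_junta`: the exact fibre/section identity on a sum ground set `ι ⊕ κ`) with the transport
`famMap` of `…TwoPartitionFibre` along `Equiv.sumCompl : ↥J ⊕ ↥Jᶜ ≃ α` and `Fin #J ≃ ↥J`.

**`threeSetN_nonneg_of_dependsOn`**: if `0 ≤ threeSetN` for all up-set triples of `2^[n]` for every `n ≤ k` (hypothesis), `𝒜 ⊆ 2^α` is an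
up-set with `S ∈ 𝒜 ↔ S ∩ J ∈ 𝒜` and `#J ≤ k`, then `0 ≤ threeSetN 𝒜 ℬ 𝒞` for all up-sets `ℬ, 𝒞 ⊆ 2^α`.
The hypothesis at `k = 6` is exactly what the exhaustive censuses verified (kit j237065: all triples on `2^[k]`, `k ≤ 5`; kit j243546:
`k = 6`, one SAT instance per `S_6`-orbit of `𝒜`, 16 353 classes, all UNSAT) — evidence, NOT a kernel fact; so a counterexample to
`ThreeSetAntipodal`, if one exists, has `𝒜` depending on at least seven coordinates.  HONEST LABEL: conditional lift; the conjecture is open.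
[this work]
-/

namespace Summit.CriticalPhenomena.PercolationContinuityZ3.Theorems.TwoPartition

open Finset
open scoped FinsetFamily

/-! ### From `ι ⊕ κ` to an arbitrary cube: families depending only on the coordinates in `J ⊆ α` -/

section DependsOn

variable {α : Type*} [DecidableEq α] [Fintype α]

/-- The restriction of a family `𝒜 ⊆ 2^α` to the sub-cube `2^J`, as a family of subsets of the subtype `↥J`:
`{e ⊆ J : e ∈ 𝒜}`. [this work] -/
def restrictFam (J : Finset α) (𝒜 : Finset (Finset α)) : Finset (Finset {x // x ∈ J}) :=
  univ.filter fun e => e.map (Function.Embedding.subtype _) ∈ 𝒜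

omit [Fintype α] in
/-- Membership in the restricted family. [this work] -/
@[simp] theorem mem_restrictFam [Fintype α] {J : Finset α} {𝒜 : Finset (Finset α)} {e : Finset {x // x ∈ J}} :
    e ∈ restrictFam J 𝒜 ↔ e.map (Function.Embedding.subtype _) ∈ 𝒜 := by
  simp [restrictFam]

/-- The restriction of an up-set is an up-set. [this work] -/
theorem isUpperSet_restrictFam (J : Finset α) {𝒜 : Finset (Finset α)} (h𝒜 : IsUpperSet (𝒜 : Set (Finset α))) :
    IsUpperSet ((restrictFam J 𝒜 : Finset (Finset {x // x ∈ J})) : Set (Finset {x // x ∈ J})) := by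
  intro e e' hee' he
  rw [Finset.mem_coe, mem_restrictFam] at he ⊢
  exact h𝒜 (map_subset_map.2 hee') he

omit [Fintype α] in
/-- The `J`-part of a set read through `Equiv.sumCompl`: for `S' ⊆ ↥J ⊕ ↥Jᶜ`, the members of `J` in the image of `S'` are exactly
the image of `S'.toLeft`. [this work] -/
theorem map_sumCompl_inter (J : Finset α) (S' : Finset ({x // x ∈ J} ⊕ {x // x ∉ J})) :
    S'.map (Equiv.sumCompl fun x => x ∈ J).toEmbedding ∩ J = (S'.toLeft.map (Function.Embedding.subtype _)) ∩ J := by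
  ext x
  simp only [mem_inter, mem_map_equiv, and_congr_left_iff]
  intro hx
  rw [Equiv.sumCompl_symm_apply_of_pos hx]
  constructor
  · intro h
    exact Finset.mem_map.2 ⟨⟨x, hx⟩, mem_toLeft.2 h, rfl⟩
  · intro h
    obtain ⟨y, hy, hyx⟩ := Finset.mem_map.1 h
    have : y = ⟨x, hx⟩ := Subtype.ext (by simpa using hyx)
    rw [this] at hy
    exact mem_toLeft.1 hy

omit [Fintype α] in
/-- The image of a set of members of `J` lies in `J`. [folklore] -/
theorem map_subtype_inter_self [Fintype α] (J : Finset α) (e : Finset {x // x ∈ J}) :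
    e.map (Function.Embedding.subtype _) ∩ J = e.map (Function.Embedding.subtype _) := by
  refine inter_eq_left.2 fun x hx => ?_
  obtain ⟨y, _, rfl⟩ := Finset.mem_map.1 hx
  exact y.2

/-- **The junta lift on an arbitrary finite cube** (this work).  Let `𝒜 ⊆ 2^α` be an up-set depending only on the coordinates in
`J` (`S ∈ 𝒜 ↔ S ∩ J ∈ 𝒜`).  If the three-set antipodal functional is nonnegative for ALL up-set triples of the cubes `2^[n]`, `n ≤ k`,
and `#J ≤ k`, then `0 ≤ threeSetN 𝒜 ℬ 𝒞` for all up-sets `ℬ, 𝒞 ⊆ 2^α` — whatever the size of `α`.  (The hypothesis for `k = 6` is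
what the exhaustive censuses kit j237065 (`k ≤ 5`) and j243546 (`k = 6`) verified; it is NOT a kernel fact.) [this work] -/
theorem threeSetN_nonneg_of_dependsOn {k : ℕ}
    (hbase : ∀ n, n ≤ k → ∀ 𝒜 ℬ 𝒞 : Finset (Finset (Fin n)), IsUpperSet (𝒜 : Set (Finset (Fin n))) →
      IsUpperSet (ℬ : Set (Finset (Fin n))) → IsUpperSet (𝒞 : Set (Finset (Fin n))) → 0 ≤ threeSetN 𝒜 ℬ 𝒞)
    (J : Finset α) (hJ : #J ≤ k) {𝒜 ℬ 𝒞 : Finset (Finset α)} (hdep : ∀ S, S ∈ 𝒜 ↔ S ∩ J ∈ 𝒜)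
    (h𝒜 : IsUpperSet (𝒜 : Set (Finset α))) (hℬ : IsUpperSet (ℬ : Set (Finset α))) (h𝒞 : IsUpperSet (𝒞 : Set (Finset α))) :
    0 ≤ threeSetN 𝒜 ℬ 𝒞 := by
  classical
  set e := (Equiv.sumCompl fun x => x ∈ J) with he
  -- transport to the ground type `↥J ⊕ ↥Jᶜ`
  rw [← threeSetN_famMap e.symm]
  -- the transported `𝒜` depends only on the left part
  have hjunta : ∀ S', S' ∈ famMap e.symm 𝒜 ↔ S'.toLeft ∈ restrictFam J 𝒜 := by
    intro S'
    rw [mem_famMap, Equiv.symm_symm, mem_restrictFam, hdep, map_sumCompl_inter,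
      hdep (Finset.map (Function.Embedding.subtype _) S'.toLeft), map_subtype_inter_self]
  -- the conjecture on the small cube `2^J`, transported from `Fin #J`
  have hsmall : ∀ ℬ' 𝒞' : Finset (Finset {x // x ∈ J}), IsUpperSet (ℬ' : Set (Finset {x // x ∈ J})) →
      IsUpperSet (𝒞' : Set (Finset {x // x ∈ J})) → 0 ≤ threeSetN (restrictFam J 𝒜) ℬ' 𝒞' := by
    intro ℬ' 𝒞' hℬ' h𝒞'
    let f := Fintype.equivFin {x // x ∈ J}
    rw [← threeSetN_famMap f]
    refine hbase _ ?_ _ _ _ (isUpperSet_famMap f (isUpperSet_restrictFam J h𝒜)) (isUpperSet_famMap f hℬ')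
      (isUpperSet_famMap f h𝒞')
    rw [Fintype.card_coe]; exact hJ
  exact threeSetN_nonneg_of_junta hsmall hjunta (isUpperSet_famMap e.symm hℬ) (isUpperSet_famMap e.symm h𝒞)

end DependsOn

end Summit.CriticalPhenomena.PercolationContinuityZ3.Theorems.TwoPartition
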